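import Summits.Ventures.CertifiedArithmetic.LowPrec.GemmThetaLawGenDefs

/-!
# The E2M3×E2M3 all-precision law as `LawData`; level `top` checked

HONEST FRAMING (venture CertifiedArithmetic / cell `pub-lowprec`, seat gemm, gen 13): certified
error envelopes and provably optimal rounding/accumulation schemes for low-precision formats under
stated cost models; every table by two implementations; no hardware or vendor claims.

`e2m3Law` is the product alphabet E2M3×E2M3 (grid `2^-6`, 443 signed letters, `x_max = 3600`) with
the law of paper `gemm.tex` Theorem t:thetap6 (E2M3 row) in the symbolic regime `M = 1024·K`, `K ≥
2`, i.e. EVERY `p ≥ 12`. The check `LawData.lawCheck` (46,348 classes, the design aid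
`symsplit_proto.py e2m3 11` count) is split by level over this file (`top`, side conditions) and
`GemmThetaLawGenE2M3Check1..N.lean`; `GemmThetaLawGenE2M3.lean` assembles `lawCheck_e2m3`.
Executable half of the certificate; `GemmThetaLawGenE2M3Cert.lean` reads it through the landed
soundness theorem `LawData.lawCheck_cert` (`GemmThetaLawGenCert.lean`).
-/

namespace Literature.ComputerArithmetic.FloatingPoint

namespace MiniFloat

namespace ThetaLaw

/-- E2M3×E2M3 products (grid `2^-6`) with the law of gemm.tex Thm t:thetap6 (E2M3 row): `B =
(2,3,4,5,6,8,9,10,12,16,24,40)`, `S = (2,2,2,2,4,2,2,4,8,16,32,64)`, `J = 11`, `θ = (5M + 8)/252 =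
(5·2^(p-3) + 2)/63`, `κ = 2^10/(24·M + 32)`, `ρ = 63/2`, `β_pair = 191/2`; symbolic regime `M =
1024·K`, `K ≥ 2` (every `p ≥ 12`; regime floor `2M > x_max = 3600`). [cell, laws.py] -/
def e2m3Law : LawData :=
  { X := [
      1, 2, 3, 4, 5, 6, 7, 8, 9, 10, 11, 12, 13, 14, 15, 16, 18, 20, 21, 22, 24, 25, 26, 27,
      28, 30, 32, 33, 35, 36, 39, 40, 42, 44, 45, 48, 49, 50, 52, 54, 55, 56, 60, 63, 64, 65,
      66, 70, 72, 75, 77, 78, 80, 81, 84, 88, 90, 91, 96, 98, 99, 100, 104, 105, 108, 110, 112,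
      117, 120, 121, 126, 128, 130, 132, 135, 140, 143, 144, 150, 154, 156, 160, 162, 165, 168,
      169, 176, 180, 182, 192, 195, 196, 198, 200, 208, 210, 216, 220, 224, 225, 234, 240, 242,
      252, 256, 260, 264, 270, 280, 286, 288, 300, 308, 312, 320, 324, 330, 336, 338, 352, 360,
      364, 384, 390, 392, 396, 400, 416, 420, 432, 440, 448, 450, 468, 480, 484, 504, 512, 520,
      528, 540, 560, 572, 576, 600, 616, 624, 640, 648, 660, 672, 676, 704, 720, 728, 768, 780,
      784, 792, 800, 832, 840, 864, 880, 896, 900, 936, 960, 968, 1008, 1024, 1040, 1056, 1080,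
      1120, 1144, 1152, 1200, 1232, 1248, 1280, 1296, 1320, 1344, 1352, 1408, 1440, 1456, 1536,
      1560, 1568, 1584, 1600, 1664, 1680, 1728, 1760, 1792, 1800, 1872, 1920, 1936, 2016, 2080,
      2112, 2160, 2240, 2288, 2304, 2400, 2464, 2496, 2640, 2688, 2704, 2880, 2912, 3120, 3136,
      3360, 3600],
    J := 11,
    B := [2, 3, 4, 5, 6, 8, 9, 10, 12, 16, 24, 40],
    S := [2, 2, 2, 2, 4, 2, 2, 4, 8, 16, 32, 64],
    th1 := 5, th0 := 8, thD := 252, kb := 10, rhoN := 63, rhoD := 2, betaN := 191, betaD := 2,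
    M0 := 1024, K0 := 2, fixed := false }

/-- Side conditions of the E2M3×E2M3 regime. [cell, kernel] -/
theorem sideOK_e2m3 : e2m3Law.sideOK = true := by
  decide +kernel

/-- Level `top` of the E2M3×E2M3 law check passes (886 classes, both signs, all 443 letters).
[cell, kernel `decide`] -/
theorem levCheck_e2m3_top : e2m3Law.levCheck (Lev.top) = true := by
  decide +kernel

end ThetaLaw

end MiniFloat

end Literature.ComputerArithmetic.FloatingPoint
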